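import Summits.BirchSwinnertonDyer.Rank1Residual.ManinAdditive.QuarterShiftTwistOrbit
import Summits.BirchSwinnertonDyer.Rank1Residual.ManinAdditive.MinusOneOrbitManinEqHolds
import Summits.BirchSwinnertonDyer.BirchSwinnertonDyer.Theorems.ManinLocalTwoThreeUFamilyNegOneTwin
import HarnessLib

/-!
# E-es-166 `NegOneTwistDiscrEqOfAdditive` is a THEOREM (Connell–Pal, already in the tree), hence es's THEOREM 55.I
# «`|c′| = |c|` along EVERY `χ₋₄` edge `N ∣ N′ ∣ 4N`, `16 ∣ N′`» is UNCONDITIONAL; and S-es-g34-2♭ BY NAME modulo modularity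
# (cell `bsd-f2-manin`, es g34 §55.8 / typer T-es-64 `ManinAdditive/QuarterShiftTwistOrbit.lean`; crux C2 `ManinOddAtFour`,
# stmt-BirchSwinnertonDyer-22967; prover p2 gen 19)

Summit `BirchSwinnertonDyer`, route `ManinLocalTwoThree`; deciding theorem of the line = C2
`Summit.BirchSwinnertonDyer.BirchSwinnertonDyer.Theses.ManinLocalTwoThree.ManinOddAtFour` (NOT proved here).

* **E-es-166 HOLDS** (`negOneTwistDiscrEqOfAdditive_holds`): es filed `NegOneTwistDiscrEqOfAdditive` (two globally minimal models,
  both additive at `2`, one `ℚ`-isomorphic to the `χ₋₄`-twist of the other, have the same discriminant) as a LAW «because the tree has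
  no Kraus realizability theorem yet».  It is, with the variable change bound existentially, EXACTLY an's printed local lemma S-an-10
  `NegOneTwistMinimalDiscrEq`, discharged in the tree as `negOneTwistMinimalDiscrEq_holds`
  (`ManinAdditive/MinusOneOrbitManinEqHolds.lean`, from the Literature fact
  `connellPal_Δ_eq_of_negOne_twist_of_four_dvd_conductor_holds`, Pal 2012 Prop. 2.4 / Connell 5.7.3: `u = ±1` from Kraus at `2`).
* Hence es's kernel glue is UNCONDITIONAL: `negOneTwistSameLevelDiscrEq_of_law` (an's clause at every `M` with `4 ∣ M` — also an's own
  `negOneTwistSameLevelDiscrEq_holds`), **`maninConstant_natAbs_eq_of_dvd`** (THEOREM 55.I: `|c′| = |c|` along every `χ₋₄` edge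
  `N ∣ N′ ∣ 4N`, `16 ∣ N′`, of lattice-optimal data on globally minimal curves additive at `2`) and
  **`two_dvd_maninConstant_iff_of_dvd`** (C2 is CONSTANT on such `χ₋₄`-orbits) — one uniform statement covering an's three separately
  landed cases `N′ = N` (THEOREM I `minusOneOrbitManinEq_holds`), `N′ = 2N` (`minusOneLevelRaisingByTwoOptimalOrbit_holds`) and
  `N′ = 4N` (E-an-145R `minusOneLevelRaisingOptimalOrbit_holds`).
* **S-es-g34-2♭ `UFamilyOptimalNegOneTwinAtSixteenFlat` HOLDS granted modularity** (`uFamilyOptimalNegOneTwinAtSixteenFlat_of_modularity`):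
  S-es-g34-2 (`UFamilyTwin.uFamilyOptimalNegOneTwinAtSixteen_of_modularity`, p743305) with the discriminant clause dropped.

HONEST FRAMING.  Bookkeeping over tree theorems; `exists_isNewformOf` (Modularity) is the only hypothesis of the `_of_modularity`
statement, the others are unconditional.  Nothing here proves `ManinOddAtFour`, Manin's conjecture or BSD.  No `sorry`, no definition,
no named fact; standard axioms.  References: [Pal2012] Prop. 2.4 (2)(b)(iii); [Connell1999] §5.7.3; [SilvermanAEC2009] VIII.8.
-/

set_option linter.dupNamespace false
set_option autoImplicit false

noncomputable section

open scoped MatrixGroups ModularForm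

open CongruenceSubgroup WeierstrassCurve
  Literature.NumberTheory.DiophantineGeometry
  Literature.NumberTheory.EllipticCurves
  Literature.NumberTheory.EllipticCurves.ModularForms
  Summit.BirchSwinnertonDyer.Rank1Residual.ManinAdditive

namespace Summit.BirchSwinnertonDyer.BirchSwinnertonDyer.Theorems.ManinLocalTwoThree.UFamilyTwin

/-! ## §1 E-es-166 BY NAME, unconditionally -/

/-- **E-es-166 `NegOneTwistDiscrEqOfAdditive` HOLDS** — it is an's S-an-10 `NegOneTwistMinimalDiscrEq` (tree theorem
`negOneTwistMinimalDiscrEq_holds`, Connell–Pal) with the variable change bound existentially. [cite: Pal2012, Prop. 2.4 (2)(b)(iii)] -/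
theorem negOneTwistDiscrEqOfAdditive_holds : NegOneTwistDiscrEqOfAdditive := by
  intro W W' _ _ _ _ h4 h4' hu
  obtain ⟨u, hu⟩ := hu
  exact negOneTwistMinimalDiscrEq_holds W W' u h4 h4' hu

/-- an's same-level clause `NegOneTwistSameLevelDiscrEq M` for every `M` with `4 ∣ M`, through es's glue (cf. an's
`negOneTwistSameLevelDiscrEq_holds`). [cite: Pal2012, Prop. 2.4 (2)(b)(iii)] -/
theorem negOneTwistSameLevelDiscrEq_of_law (M : ℕ) (hM : 2 ^ 2 ∣ M) : NegOneTwistSameLevelDiscrEq M :=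
  negOneTwistSameLevelDiscrEq_of_discrLaw negOneTwistDiscrEqOfAdditive_holds M hM

/-! ## §2 THEOREM 55.I unconditionally: `|c′| = |c|` and `2 ∣ c′ ↔ 2 ∣ c` along every `χ₋₄` edge `N ∣ N′ ∣ 4N`, `16 ∣ N′` -/

/-- **THEOREM 55.I (es §55.8), UNCONDITIONAL: `|c′| = |c|` along every `χ₋₄` edge `N ∣ N′ ∣ 4N`, `16 ∣ N′`, of lattice-optimal data on
globally minimal curves additive at `2`** (es's `maninConstant_natAbs_eq_of_dvd_of_discrLaw` fed with E-es-166 = Connell–Pal).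
[cite: Pal2012, Prop. 2.4 (2)(b)(iii)] -/
theorem maninConstant_natAbs_eq_of_dvd
    {W W' : WeierstrassCurve ℚ} [W.IsElliptic] [W'.IsElliptic] [W.IsGloballyMinimal] [W'.IsGloballyMinimal]
    {N N' : ℕ} [NeZero N] [NeZero N'] (D : ModularParametrizationData W N)
    (D' : ModularParametrizationData W' N') (hD : IsLatticeOptimal D) (hD' : IsLatticeOptimal D')
    (hNN' : N ∣ N') (hN'4 : N' ∣ 4 * N) (h16 : 4 ^ 2 ∣ N')
    (h4W : 2 ^ 2 ∣ W.conductorNorm ℤ) (h4W' : 2 ^ 2 ∣ W'.conductorNorm ℤ)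
    (hiso : IsIsogenous (W.quadraticTwist ((-1 : ℤ) : ℚ)) W') : D'.c.natAbs = D.c.natAbs :=
  maninConstant_natAbs_eq_of_dvd_of_discrLaw negOneTwistDiscrEqOfAdditive_holds D D' hD hD' hNN' hN'4 h16 h4W h4W' hiso

/-- **C2 is CONSTANT on `χ₋₄`-orbits, UNCONDITIONALLY: `2 ∣ c′ ↔ 2 ∣ c`** along every `χ₋₄` edge `N ∣ N′ ∣ 4N`, `16 ∣ N′`, of
lattice-optimal data on globally minimal curves additive at `2` (uniform over an's cases `N′ ∈ {N, 2N, 4N}`).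
[cite: Pal2012, Prop. 2.4 (2)(b)(iii)] -/
theorem two_dvd_maninConstant_iff_of_dvd
    {W W' : WeierstrassCurve ℚ} [W.IsElliptic] [W'.IsElliptic] [W.IsGloballyMinimal] [W'.IsGloballyMinimal]
    {N N' : ℕ} [NeZero N] [NeZero N'] (D : ModularParametrizationData W N)
    (D' : ModularParametrizationData W' N') (hD : IsLatticeOptimal D) (hD' : IsLatticeOptimal D')
    (hNN' : N ∣ N') (hN'4 : N' ∣ 4 * N) (h16 : 4 ^ 2 ∣ N')
    (h4W : 2 ^ 2 ∣ W.conductorNorm ℤ) (h4W' : 2 ^ 2 ∣ W'.conductorNorm ℤ)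
    (hiso : IsIsogenous (W.quadraticTwist ((-1 : ℤ) : ℚ)) W') : 2 ∣ D'.c ↔ 2 ∣ D.c :=
  two_dvd_maninConstant_iff_of_dvd_of_discrLaw negOneTwistDiscrEqOfAdditive_holds D D' hD hD' hNN' hN'4 h16 h4W h4W' hiso

/-! ## §3 S-es-g34-2♭ BY NAME, modulo modularity -/

/-- **S-es-g34-2♭ `UFamilyOptimalNegOneTwinAtSixteenFlat` HOLDS granted modularity** (S-es-g34-2 with the discriminant clause
dropped; see `uFamilyOptimalNegOneTwinAtSixteen_of_modularity`). [cite: EdixhovenManin1991, Prop. 2] -/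
theorem uFamilyOptimalNegOneTwinAtSixteenFlat_of_modularity (hnf : exists_isNewformOf) :
    UFamilyOptimalNegOneTwinAtSixteenFlat := by
  intro W' _ _ _ D' u hD' hU hu3 h16 h32
  obtain ⟨W, hE, hmin, hN0, D, hD, hUW, hN, hiso, -⟩ :=
    uFamilyOptimalNegOneTwinAtSixteen_of_modularity hnf W' D' u hD' hU hu3 h16 h32
  exact ⟨W, hE, hmin, hN0, D, hD, hUW, hN, hiso⟩

end Summit.BirchSwinnertonDyer.BirchSwinnertonDyer.Theorems.ManinLocalTwoThree.UFamilyTwin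

end
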